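import Literature.Geometry.Riemannian.MetricFlowFLimitPairAux2
import Literature.Geometry.Riemannian.MetricFlowFLimitReproduction
import Literature.Geometry.Riemannian.MeasureLipschitzToolkit
import Literature.Geometry.Riemannian.MeasureSupportSpace
import HarnessLib

/-!
# The limit of a fast `𝔽`-Cauchy chain within a correspondence, III: the limit slices and kernels
# as metric measure data (Bamler 2023, §5.4, Lemma 5.20, Claims 5.21–5.22)

R. Bamler, *Compactness theory of the space of super Ricci flows*, Invent. Math. 233 (2023), §5.4,
proof of Lemma 5.20 (arXiv v1 Lemma 121): *"Let `X^∞_t := supp μ^∞_t` and `d^∞_t := d^Z_t|_{X^∞_t}`.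
Then `(X^∞_t, d^∞_t, μ^∞_t)` is a complete, separable metric measure space of full support. …
Applying Claim 5.21 for any `s, t ∈ I ∖ E^∞`, `s ≤ t` and `x^∞ ∈ X^∞_t` produces a families of
probability measures `ν^∞_{x^∞;s} ∈ 𝒫(X^∞_s)`, which we will fix henceforth. … Let moreover
`(φ^∞_t : 𝒳^∞_t = X^∞_t → Z_t)` be the family of inclusion maps."* and, in the proof of Claim 5.22
(arXiv v1 Claim 123): *"It suffices to show that for every bounded Lipschitz function `f` …"*.

Continuing `MetricFlowFLimitPairAux2.lean`, this file turns the limit measures `μ^∞_t ∈ 𝒫(Z_t)` and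
limit kernels `ν^∞_{z;s} ∈ 𝒫(Z_s)` of the fast chain `S : ChainSetup I₀` into data living on the
limit slices, and provides the measure-theoretic passage from Lipschitz test functions to sets:

* `ChainSetup.wassersteinW1_νZ_le_edist` (`d_{W₁}(ν^∞_{z;s}, ν^∞_{z';s}) ≤ d_t(z, z')`, by lower
  semicontinuity of `d_{W₁}`) and `ChainSetup.νZ_self` (`ν^∞_{z;t} = δ_z`);
* `ChainSetup.X t ht` — the limit slice `X^∞_t := supp μ^∞_t`, a closed subspace of `Z_t` (complete,
  separable, Borel; instances from `MeasureSupportSpace.lean`);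
* `ChainSetup.kernel ht x hs` — `ν^∞_{x;s}` as a measure ON `X^∞_s` (`Measure.comap Subtype.val`), a
  probability measure for `s ≤ t` pushing forward to `ν^∞_{x;s}` under the inclusion
  (`map_val_kernel`), with `kernel_self : ν^∞_{x;t} = δ_x`;
* transport of integrals along the inclusion `X^∞_s → Z_s` (`integral_comap_subtype_val`,
  `lintegral_comap_subtype_val`), Lipschitz extension from `X^∞_s` to `Z_s`
  (`exists_lipschitz_extension`, `exists_lipschitz_extension_Icc`), the Lipschitz dependence
  `x ↦ ∫ g dν^∞_{x;s}` (`lipschitzWith_integral_νZ`) and the measurability of `x ↦ ν^∞_{x;s}`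
  (`measurable_kernel`, through `measurable_measure_of_forall_lipschitz`);
* `ChainSetup.comap_apply_eq_lintegral_kernel` — **from the Lipschitz-integral identity
  `∫ g dσ = ∫ (∫ g dν^∞_{w;s}) dρ(w)` (all Lipschitz `g : Z_s → [0, 1]`) to the set identity
  `σ(A) = ∫ ν^∞_{x;s}(A) dρ(x)` on the limit slices** (`ext_of_forall_integral_lipschitz_eq`), the
  common final step of the reproduction formula and of the conjugate heat flow property of the
limit.

## References

* R. H. Bamler, *Compactness theory of the space of super Ricci flows*, Invent. Math. 233 (2023),
  1121–1277 (arXiv:2008.09298), §5.4, Lemma 5.20, Claims 5.21–5.22 (arXiv v1 Lemma 121,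
  Claims 122–123). [Bamler2023]
-/

noncomputable section

open Set MeasureTheory Filter TopologicalSpace Function ProbabilityTheory
open scoped Topology ENNReal NNReal

namespace Literature.Geometry.Riemannian

universe u

/-! ### Transport along the inclusion of a subset, Lipschitz extension -/

section Transport

/-- `∫⁻ g d(ν|_F) = ∫⁻ g dν` on the subtype `F`, for `ν` carried by the measurable set `F`.
[folklore] -/
theorem lintegral_comap_subtype_val {Z : Type*} [MeasurableSpace Z] {F : Set Z}
    (hF : MeasurableSet F) {ν : Measure Z} (hν : ν Fᶜ = 0) (g : Z → ℝ≥0∞) :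
    ∫⁻ y : F, g y.1 ∂(Measure.comap Subtype.val ν) = ∫⁻ z, g z ∂ν := by
  rw [lintegral_subtype_comap hF, Measure.restrict_eq_self_of_ae_mem (mem_ae_iff.2 hν)]

/-- `∫ g d(ν|_F) = ∫ g dν` on the subtype `F`, for `ν` carried by the measurable set `F`.
[folklore] -/
theorem integral_comap_subtype_val {Z : Type*} [MeasurableSpace Z] {F : Set Z}
    (hF : MeasurableSet F) {ν : Measure Z} (hν : ν Fᶜ = 0) (g : Z → ℝ) :
    ∫ y : F, g y.1 ∂(Measure.comap Subtype.val ν) = ∫ z, g z ∂ν := by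
  rw [integral_subtype_comap hF, Measure.restrict_eq_self_of_ae_mem (mem_ae_iff.2 hν)]

/-- `(ν|_F)` pushes forward to `ν` under the inclusion, for `ν` carried by `F`. [folklore] -/
theorem map_val_comap_subtype_val {Z : Type*} [MeasurableSpace Z] {F : Set Z}
    (hF : MeasurableSet F) {ν : Measure Z} (hν : ν Fᶜ = 0) :
    (Measure.comap Subtype.val ν).map (Subtype.val : F → Z) = ν := by
  rw [map_comap_subtype_coe hF, Measure.restrict_eq_self_of_ae_mem (mem_ae_iff.2 hν)]

/-- **Lipschitz functions on a subset extend with the same constant** (McShane), phrased for a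
function on the subtype. [folklore] -/
theorem exists_lipschitz_extension {Z : Type*} [PseudoMetricSpace Z] {F : Set Z} {K : ℝ≥0}
    (u : F → ℝ) (hu : LipschitzWith K u) :
    ∃ g : Z → ℝ, LipschitzWith K g ∧ ∀ y : F, g y.1 = u y := by
  classical
  set g₀ : Z → ℝ := fun z ↦ if h : z ∈ F then u ⟨z, h⟩ else 0 with hg₀_def
  have hg₀ : LipschitzOnWith K g₀ F := by
    intro z hz z' hz'
    simp only [hg₀_def, dif_pos hz, dif_pos hz']
    exact hu ⟨z, hz⟩ ⟨z', hz'⟩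
  obtain ⟨g, hg, hEq⟩ := hg₀.extend_real
  refine ⟨g, hg, fun y ↦ ?_⟩
  rw [← hEq y.2]
  simp only [hg₀_def, dif_pos y.2]

/-- Lipschitz `[0, 1]`-valued functions on a subset extend to Lipschitz `[0, 1]`-valued functions
(extend, then clamp to `[0, 1]`). [folklore] -/
theorem exists_lipschitz_extension_Icc {Z : Type*} [PseudoMetricSpace Z] {F : Set Z} {K : ℝ≥0}
    (u : F → ℝ) (hu : LipschitzWith K u) (h01 : ∀ y, u y ∈ Icc (0 : ℝ) 1) :
    ∃ g : Z → ℝ, LipschitzWith K g ∧ (∀ z, g z ∈ Icc (0 : ℝ) 1) ∧ ∀ y : F, g y.1 = u y := by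
  obtain ⟨g, hg, hgu⟩ := exists_lipschitz_extension u hu
  refine ⟨fun z ↦ min (max (g z) 0) 1, (hg.max_const 0).min_const 1,
    fun z ↦ ⟨le_min (le_max_right _ _) zero_le_one, min_le_right _ _⟩, fun y ↦ ?_⟩
  obtain ⟨h0, h1⟩ := h01 y
  dsimp only
  rw [hgu y, max_eq_left h0, min_eq_left h1]

/-- A `[0, 1]`-valued function is bounded by `1` in absolute value. [folklore] -/
theorem abs_le_one_of_mem_Icc {α : Type*} {g : α → ℝ} (h : ∀ z, g z ∈ Icc (0 : ℝ) 1) (z : α) :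
    |g z| ≤ 1 :=
  abs_le.2 ⟨by linarith [(h z).1], (h z).2⟩

end Transport

namespace MetricFlowPair

open MetricFlow

namespace ChainSetup

variable {I₀ : Set ℝ} (S : ChainSetup.{u} I₀)

/-! ### Lipschitz dependence of the limit kernels on the base point; `ν^∞_{z;t} = δ_z` -/

/-- **The limit kernels are `1`-Lipschitz in the base point**:
`d_{W₁}(ν^∞_{z;s}, ν^∞_{z';s}) ≤ d^Z_t(z, z')` for `z, z' ∈ supp μ^∞_t` (limit of
`d_{W₁}((φ_s)_* ν_{x_k;s}, (φ_s)_* ν_{x'_k;s}) ≤ d_t(x_k, x'_k)` by lower semicontinuity of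
`d_{W₁}`). [cite: Bamler2023, §5.4, Lemma 5.20, proof] -/
theorem wassersteinW1_νZ_le_edist {s t : ℝ} (hs : s ∈ S.I') (ht : t ∈ S.I') (hst : s ≤ t)
    {z z' : S.ℭ.Z ⟨t, ht.1⟩} (hz : z ∈ (S.m t ht).support) (hz' : z' ∈ (S.m t ht).support) :
    wassersteinW1 (S.νZ hs ht z) (S.νZ hs ht z') ≤ edist z z' := by
  obtain ⟨i, hsi, hti⟩ := S.exists_mem_G₂ hs ht
  obtain ⟨x, hx⟩ := S.exists_seq_tendsto ht hti hz
  obtain ⟨x', hx'⟩ := S.exists_seq_tendsto ht hti hz'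
  haveI := S.isProbabilityMeasure_νZ hs ht hst hz
  haveI := S.isProbabilityMeasure_νZ hs ht hst hz'
  haveI := fun k ↦ S.isProbabilityMeasure_kpush (i + k) hs.1 (S.memDom hsi k) (S.memDom hti k) hst
    (x k)
  haveI := fun k ↦ S.isProbabilityMeasure_kpush (i + k) hs.1 (S.memDom hsi k) (S.memDom hti k) hst
    (x' k)
  have hlsc := wassersteinW1_le_liminf (X := S.ℭ.Z ⟨s, hs.1⟩)
    (μs := fun k ↦ ⟨S.kpush (i + k) hs.1 (S.memDom hsi k) (S.memDom hti k) (x k), inferInstance⟩)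
    (νs := fun k ↦ ⟨S.kpush (i + k) hs.1 (S.memDom hsi k) (S.memDom hti k) (x' k), inferInstance⟩)
    (μ := ⟨S.νZ hs ht z, inferInstance⟩) (ν := ⟨S.νZ hs ht z', inferInstance⟩)
    (tendsto_probabilityMeasure_mk_of_tendsto_wassersteinW1
      (S.tendsto_kpush_νZ hs ht hst hz hsi hti x hx))
    (tendsto_probabilityMeasure_mk_of_tendsto_wassersteinW1
      (S.tendsto_kpush_νZ hs ht hst hz' hsi hti x' hx'))
  refine hlsc.trans ?_
  have hlim : Tendsto (fun k ↦ edist (S.ℭ.φ (i + k) t (S.memDom hti k) (x k) : S.ℭ.Z ⟨t, ht.1⟩)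
      (S.ℭ.φ (i + k) t (S.memDom hti k) (x' k))) atTop (𝓝 (edist z z')) := hx.edist hx'
  rw [← hlim.liminf_eq]
  refine liminf_le_liminf (Eventually.of_forall fun k ↦ ?_)
  exact S.wassersteinW1_kpush_le_edist' rfl hs.1 ht.1 _ _ _ _ hst _ _

/-- **`ν^∞_{z;t} = δ_z`** for `z ∈ supp μ^∞_t`: at `s = t` the pushed kernels are the Dirac masses
`δ_{φ_t(x_k)} → δ_z`, and `W₁`-limits are unique.
[cite: Bamler2023, §5.4, Lemma 5.20, Claim 5.22 (arXiv v1 Claim 123)] -/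
theorem νZ_self {t : ℝ} (ht : t ∈ S.I') {z : S.ℭ.Z ⟨t, ht.1⟩} (hz : z ∈ (S.m t ht).support) :
    S.νZ ht ht z = Measure.dirac z := by
  obtain ⟨i, hti⟩ := S.exists_mem_G ht
  obtain ⟨x, hx⟩ := S.exists_seq_tendsto ht hti hz
  haveI := S.isProbabilityMeasure_νZ ht ht le_rfl hz
  haveI := fun k ↦ S.isProbabilityMeasure_kpush (i + k) ht.1 (S.memDom hti k) (S.memDom hti k)
    le_rfl (x k)
  have h₁ := tendsto_probabilityMeasure_mk_of_tendsto_wassersteinW1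
    (S.tendsto_kpush_νZ ht ht le_rfl hz hti hti x hx)
  -- the same sequence converges to `δ_z`
  have hdirac : ∀ k, S.kpush (i + k) ht.1 (S.memDom hti k) (S.memDom hti k) (x k) =
      Measure.dirac (S.ℭ.φ (i + k) t (S.memDom hti k) (x k)) := fun k ↦ by
    rw [kpush, (S.P (i + k)).flow.condKernel_self,
      Measure.map_dirac' (S.ℭ.isometry (i + k) t (S.memDom hti k)).continuous.measurable]
  have h₂' : Tendsto (fun k ↦ wassersteinW1 (S.kpush (i + k) ht.1 (S.memDom hti k) (S.memDom hti k)
      (x k)) (Measure.dirac z)) atTop (𝓝 0) := by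
    refine tendsto_of_tendsto_of_tendsto_of_le_of_le tendsto_const_nhds
      (tendsto_iff_edist_tendsto_0.1 hx) (fun _ ↦ zero_le) fun k ↦ ?_
    rw [hdirac k]
    exact wassersteinW1_dirac_dirac_le _ _
  have h₂ := tendsto_probabilityMeasure_mk_of_tendsto_wassersteinW1 h₂'
  have heq := tendsto_nhds_unique h₁ h₂
  exact congrArg (fun μ : ProbabilityMeasure (S.ℭ.Z ⟨t, ht.1⟩) ↦ (μ : Measure (S.ℭ.Z ⟨t, ht.1⟩)))
    heq

/-! ### The limit slices `X^∞_t = supp μ^∞_t` and the kernels on them -/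

/-- **The limit time-slice `X^∞_t := supp μ^∞_t ⊆ Z_t`** with `d^∞_t := d^Z_t|_{X^∞_t}`
(complete and separable, `MeasureSupportSpace.lean`), `t ∈ I'^{,∞}`.
[cite: Bamler2023, §5.4, Lemma 5.20 (arXiv v1 Lemma 121), proof] -/
abbrev X (t : ℝ) (ht : t ∈ S.I') : Type u := (S.m t ht).support

/-- **The limit conjugate heat kernel `ν^∞_{x;s} ∈ 𝒫(X^∞_s)`** for `x ∈ X^∞_t` (Claim 5.21: the
`W₁`-limit `ν^∞_{x;s} ∈ 𝒫(Z_s)` has `supp ν^∞_{x;s} ⊆ X^∞_s`; here pulled back to the subtype).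
[cite: Bamler2023, §5.4, Lemma 5.20, Claim 5.21 (arXiv v1 Claim 122)] -/
def kernel {t : ℝ} (ht : t ∈ S.I') (x : S.X t ht) {s : ℝ} (hs : s ∈ S.I') : Measure (S.X s hs) :=
  Measure.comap Subtype.val (S.νZ hs ht x.1)

/-- `ν^∞_{x;s}` on `X^∞_s` pushes forward to `ν^∞_{x;s}` on `Z_s` under the inclusion (`s ≤ t`).
[cite: Bamler2023, §5.4, Lemma 5.20, Claim 5.21 (arXiv v1 Claim 122)] -/
theorem map_val_kernel {s t : ℝ} (hs : s ∈ S.I') (ht : t ∈ S.I') (hst : s ≤ t) (x : S.X t ht) :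
    (S.kernel ht x hs).map Subtype.val = S.νZ hs ht x.1 :=
  map_val_comap_subtype_val (measurableSet_support _) (S.νZ_compl_support hs ht hst x.2)

/-- `∫ g ∘ ι dν^∞_{x;s} = ∫ g dν^∞_{x;s}` (transport along the inclusion `ι : X^∞_s → Z_s`).
[folklore] -/
theorem integral_kernel_comp_val {s t : ℝ} (hs : s ∈ S.I') (ht : t ∈ S.I') (hst : s ≤ t)
    (x : S.X t ht) (g : S.ℭ.Z ⟨s, hs.1⟩ → ℝ) :
    ∫ y, g y.1 ∂(S.kernel ht x hs) = ∫ z, g z ∂(S.νZ hs ht x.1) :=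
  integral_comap_subtype_val (measurableSet_support _) (S.νZ_compl_support hs ht hst x.2) g

/-- `∫⁻ g ∘ ι dν^∞_{x;s} = ∫⁻ g dν^∞_{x;s}` (transport along the inclusion). [folklore] -/
theorem lintegral_kernel_comp_val {s t : ℝ} (hs : s ∈ S.I') (ht : t ∈ S.I') (hst : s ≤ t)
    (x : S.X t ht) (g : S.ℭ.Z ⟨s, hs.1⟩ → ℝ≥0∞) :
    ∫⁻ y, g y.1 ∂(S.kernel ht x hs) = ∫⁻ z, g z ∂(S.νZ hs ht x.1) :=
  lintegral_comap_subtype_val (measurableSet_support _) (S.νZ_compl_support hs ht hst x.2) g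

/-- Item (4) of Def. 3.2 for the limit: `ν^∞_{x;s}` is a probability measure on `X^∞_s` for `s ≤ t`.
[cite: Bamler2023, §5.4, Lemma 5.20, Claim 5.22 (arXiv v1 Claim 123)] -/
theorem isProbabilityMeasure_kernel {s t : ℝ} (hs : s ∈ S.I') (ht : t ∈ S.I') (hst : s ≤ t)
    (x : S.X t ht) : IsProbabilityMeasure (S.kernel ht x hs) := by
  haveI := S.isProbabilityMeasure_νZ hs ht hst x.2
  refine ⟨?_⟩
  rw [← preimage_univ (f := (Subtype.val : S.X s hs → S.ℭ.Z ⟨s, hs.1⟩)),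
    ← Measure.map_apply measurable_subtype_coe MeasurableSet.univ, S.map_val_kernel hs ht hst x,
    measure_univ]

/-- Item (5) of Def. 3.2 for the limit: `ν^∞_{x;t} = δ_x` (`νZ_self`).
[cite: Bamler2023, §5.4, Lemma 5.20, Claim 5.22 (arXiv v1 Claim 123)] -/
theorem kernel_self {t : ℝ} (ht : t ∈ S.I') (x : S.X t ht) :
    S.kernel ht x ht = Measure.dirac x := by
  rw [kernel, S.νZ_self ht x.2, ← Measure.map_dirac' measurable_subtype_coe,
    (measurableEmbedding_subtype_val_support _).comap_map]

/-- **`x ↦ ∫ g dν^∞_{x;s}` is `K`-Lipschitz on `X^∞_t`** for a bounded `K`-Lipschitz `g : Z_s → ℝ`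
(`d_{W₁}(ν^∞_{x;s}, ν^∞_{x';s}) ≤ d_t(x, x')` and the easy half of Kantorovich duality); the
source's
*"the functions `hⁱ` … are uniformly Lipschitz"* in the limit.
[cite: Bamler2023, §5.4, Lemma 5.20, Claim 5.22 (arXiv v1 Claim 123), proof] -/
theorem lipschitzWith_integral_νZ {s t : ℝ} (hs : s ∈ S.I') (ht : t ∈ S.I') (hst : s ≤ t)
    {g : S.ℭ.Z ⟨s, hs.1⟩ → ℝ} {K : ℝ≥0} (hg : LipschitzWith K g) {C : ℝ} (hgC : ∀ z, |g z| ≤ C) :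
    LipschitzWith K fun x : S.X t ht ↦ ∫ z, g z ∂(S.νZ hs ht x.1) := by
  refine LipschitzWith.of_dist_le_mul fun x y ↦ ?_
  haveI := S.isProbabilityMeasure_νZ hs ht hst x.2
  haveI := S.isProbabilityMeasure_νZ hs ht hst y.2
  have hW := S.wassersteinW1_νZ_le_edist hs ht hst x.2 y.2
  have hfin : wassersteinW1 (S.νZ hs ht x.1) (S.νZ hs ht y.1) ≠ ∞ :=
    ne_top_of_le_ne_top (edist_ne_top _ _) hW
  rw [Real.dist_eq]
  calc |∫ z, g z ∂(S.νZ hs ht x.1) - ∫ z, g z ∂(S.νZ hs ht y.1)|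
      ≤ K * (wassersteinW1 (S.νZ hs ht x.1) (S.νZ hs ht y.1)).toReal :=
        abs_integral_sub_integral_le_mul_wassersteinW1 _ _ hg hgC hfin
    _ ≤ K * dist x y := by
        gcongr
        exact ENNReal.toReal_le_of_le_ofReal dist_nonneg (edist_dist x.1 y.1 ▸ hW)

/-- `∫ u dν^∞_{x;s} = ∫ g dν^∞_{x;s}` when `g : Z_s → ℝ` extends `u : X^∞_s → ℝ`. [folklore] -/
theorem integral_kernel_eq_of_extension {s t : ℝ} (hs : s ∈ S.I') (ht : t ∈ S.I') (hst : s ≤ t)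
    (x : S.X t ht) {u : S.X s hs → ℝ} {g : S.ℭ.Z ⟨s, hs.1⟩ → ℝ}
    (hgu : ∀ y : S.X s hs, g y.1 = u y) :
    ∫ y, u y ∂(S.kernel ht x hs) = ∫ z, g z ∂(S.νZ hs ht x.1) := by
  rw [← S.integral_kernel_comp_val hs ht hst x g]
  exact integral_congr_ae (Eventually.of_forall fun y ↦ (hgu y).symm)

/-- **`x ↦ ν^∞_{x;s}` is measurable on `X^∞_t`** (`s ≤ t`): against a Lipschitz `[0, 1]`-valued test
function `u` on `X^∞_s`, extended to `Z_s`, `x ↦ ∫ u dν^∞_{x;s}` is Lipschitz, and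
`measurable_measure_of_forall_lipschitz` applies.
[cite: Bamler2023, §5.4, Lemma 5.20, Claim 5.22 (arXiv v1 Claim 123), proof] -/
theorem measurable_kernel {s t : ℝ} (hs : s ∈ S.I') (ht : t ∈ S.I') (hst : s ≤ t) :
    Measurable fun x : S.X t ht ↦ S.kernel ht x hs := by
  haveI := fun x : S.X t ht ↦ S.isProbabilityMeasure_kernel hs ht hst x
  refine measurable_measure_of_forall_lipschitz _ fun u K hu h01 ↦ ?_
  obtain ⟨g, hg, hg01, hgu⟩ := exists_lipschitz_extension_Icc u hu h01
  have heq : (fun x : S.X t ht ↦ ∫ y, u y ∂(S.kernel ht x hs)) =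
      fun x ↦ ∫ z, g z ∂(S.νZ hs ht x.1) :=
    funext fun x ↦ S.integral_kernel_eq_of_extension hs ht hst x hgu
  rw [heq]
  exact (S.lipschitzWith_integral_νZ hs ht hst hg
    (abs_le_one_of_mem_Icc hg01)).continuous.measurable

/-- `ν^∞_{·;s}` as a Markov kernel `X^∞_t ⇝ X^∞_s` (`s ≤ t`).
[cite: Bamler2023, §5.4, Lemma 5.20, Claim 5.22 (arXiv v1 Claim 123)] -/
def markovKernel {s t : ℝ} (hs : s ∈ S.I') (ht : t ∈ S.I') (hst : s ≤ t) :
    Kernel (S.X t ht) (S.X s hs) where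
  toFun x := S.kernel ht x hs
  measurable' := S.measurable_kernel hs ht hst

/-- The Markov property of `ν^∞_{·;s}`.
[cite: Bamler2023, §5.4, Lemma 5.20, Claim 5.22 (arXiv v1 Claim 123)] -/
instance isMarkovKernel_markovKernel {s t : ℝ} (hs : s ∈ S.I') (ht : t ∈ S.I') (hst : s ≤ t) :
    IsMarkovKernel (S.markovKernel hs ht hst) :=
  ⟨fun x ↦ S.isProbabilityMeasure_kernel hs ht hst x⟩

/-! ### From Lipschitz test functions to sets -/

/-- A measure on `Z_t` restricted to the subtype `X^∞_t` is finite if it is. [folklore] -/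
instance isFiniteMeasure_comap_val {t : ℝ} (ht : t ∈ S.I') (ρZ : Measure (S.ℭ.Z ⟨t, ht.1⟩))
    [IsFiniteMeasure ρZ] : IsFiniteMeasure (Measure.comap (Subtype.val : S.X t ht → _) ρZ) := by
  refine ⟨?_⟩
  rw [comap_subtype_coe_apply (measurableSet_support _)]
  exact measure_lt_top _ _

/-- **From the Lipschitz-integral identity to the disintegration on the limit slices**: let `ρ` be a
finite measure on `Z_t` carried by `X^∞_t` and `σ` a finite measure on `Z_s` carried by `X^∞_s`
(`s ≤ t`) with `∫ g dσ = ∫ (∫ g dν^∞_{w;s}) dρ(w)` for all Lipschitz `g : Z_s → [0, 1]`; then, on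
the subtypes, `σ|_{X^∞_s} = ∫ ν^∞_{x;s} dρ|_{X^∞_t}(x)` as measures (`Measure.bind`). Test functions
on `X^∞_s` are extended to `Z_s`; two finite measures with the same integrals of Lipschitz
`[0, 1]`-valued functions agree (`ext_of_forall_integral_lipschitz_eq`).
[cite: Bamler2023, §5.4, Lemma 5.20, Claim 5.22 (arXiv v1 Claim 123), proof] -/
theorem comap_eq_bind_kernel {s t : ℝ} (hs : s ∈ S.I') (ht : t ∈ S.I') (hst : s ≤ t)
    (ρZ : Measure (S.ℭ.Z ⟨t, ht.1⟩)) [IsFiniteMeasure ρZ] (hρ : ρZ (S.m t ht).supportᶜ = 0)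
    (σZ : Measure (S.ℭ.Z ⟨s, hs.1⟩)) [IsFiniteMeasure σZ] (hσ : σZ (S.m s hs).supportᶜ = 0)
    (hid : ∀ (g : S.ℭ.Z ⟨s, hs.1⟩ → ℝ) (K : ℝ≥0), LipschitzWith K g → (∀ z, g z ∈ Icc (0 : ℝ) 1) →
      ∫ z, g z ∂σZ = ∫ w, (∫ z, g z ∂(S.νZ hs ht w)) ∂ρZ) :
    Measure.comap (Subtype.val : S.X s hs → _) σZ =
      (Measure.comap (Subtype.val : S.X t ht → _) ρZ).bind fun x ↦ S.kernel ht x hs := by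
  set ρ : Measure (S.X t ht) := Measure.comap Subtype.val ρZ with hρ_def
  change _ = ρ.bind (S.markovKernel hs ht hst)
  refine ext_of_forall_integral_lipschitz_eq fun u K hu h01 ↦ ?_
  obtain ⟨g, hg, hg01, hgu⟩ := exists_lipschitz_extension_Icc u hu h01
  have hgC := abs_le_one_of_mem_Icc hg01
  have hum : Measurable u := hu.continuous.measurable
  have hui : Integrable u (ρ.bind (S.markovKernel hs ht hst)) :=
    integrable_of_bounded_measurable hum (abs_le_one_of_mem_Icc h01)
  calc ∫ y, u y ∂(Measure.comap Subtype.val σZ)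
      = ∫ y : S.X s hs, g y.1 ∂(Measure.comap Subtype.val σZ) :=
        integral_congr_ae (Eventually.of_forall fun y ↦ (hgu y).symm)
    _ = ∫ z, g z ∂σZ := integral_comap_subtype_val (measurableSet_support _) hσ g
    _ = ∫ w, (∫ z, g z ∂(S.νZ hs ht w)) ∂ρZ := hid g K hg hg01
    _ = ∫ x : S.X t ht, (∫ z, g z ∂(S.νZ hs ht x.1)) ∂ρ :=
        (integral_comap_subtype_val (measurableSet_support _) hρ
          fun w ↦ ∫ z, g z ∂(S.νZ hs ht w)).symm
    _ = ∫ x, (∫ y, u y ∂(S.markovKernel hs ht hst x)) ∂ρ :=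
        integral_congr_ae (Eventually.of_forall fun x ↦
          (S.integral_kernel_eq_of_extension hs ht hst x hgu).symm)
    _ = ∫ y, u y ∂(ρ.bind (S.markovKernel hs ht hst)) :=
        (integral_comp_eq_integral_integral hui).symm

/-- **The set form**: under the hypotheses of `comap_eq_bind_kernel`,
`σ|_{X^∞_s}(A) = ∫ ν^∞_{x;s}(A) dρ|_{X^∞_t}(x)` for every measurable `A ⊆ X^∞_s` — the shape of the
reproduction formula (7) and of the conjugate heat flow property in the tree's `MetricFlow`,
`MetricFlowPair`. [cite: Bamler2023, §5.4, Lemma 5.20, Claim 5.22 (arXiv v1 Claim 123), proof] -/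
theorem comap_apply_eq_lintegral_kernel {s t : ℝ} (hs : s ∈ S.I') (ht : t ∈ S.I') (hst : s ≤ t)
    (ρZ : Measure (S.ℭ.Z ⟨t, ht.1⟩)) [IsFiniteMeasure ρZ] (hρ : ρZ (S.m t ht).supportᶜ = 0)
    (σZ : Measure (S.ℭ.Z ⟨s, hs.1⟩)) [IsFiniteMeasure σZ] (hσ : σZ (S.m s hs).supportᶜ = 0)
    (hid : ∀ (g : S.ℭ.Z ⟨s, hs.1⟩ → ℝ) (K : ℝ≥0), LipschitzWith K g → (∀ z, g z ∈ Icc (0 : ℝ) 1) →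
      ∫ z, g z ∂σZ = ∫ w, (∫ z, g z ∂(S.νZ hs ht w)) ∂ρZ)
    (A : Set (S.X s hs)) (hA : MeasurableSet A) :
    Measure.comap (Subtype.val : S.X s hs → _) σZ A =
      ∫⁻ x, S.kernel ht x hs A ∂(Measure.comap (Subtype.val : S.X t ht → _) ρZ) := by
  rw [S.comap_eq_bind_kernel hs ht hst ρZ hρ σZ hσ hid,
    Measure.bind_apply hA (S.measurable_kernel hs ht hst).aemeasurable]

/-! ### Transport of the variance -/

/-- **The variance is computed in `Z_s`**: `Var(ν^∞_{x₁;s}, ν^∞_{x₂;s})` on `X^∞_s` equals the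
variance of the measures on `Z_s` (the inclusion is an isometry and the measures are carried by
`X^∞_s`). [cite: Bamler2023, §2.2, Definition (Variance); §5.4, Lemma 5.20, proof] -/
theorem variance_kernel_eq {s t : ℝ} (hs : s ∈ S.I') (ht : t ∈ S.I') (hst : s ≤ t)
    (x₁ x₂ : S.X t ht) :
    variance (S.kernel ht x₁ hs) (S.kernel ht x₂ hs) =
      variance (S.νZ hs ht x₁.1) (S.νZ hs ht x₂.1) := by
  rw [variance_def, variance_def, ← S.lintegral_kernel_comp_val hs ht hst x₁]
  refine lintegral_congr fun a ↦ ?_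
  exact S.lintegral_kernel_comp_val hs ht hst x₂ fun z ↦ edist a.1 z ^ 2

end ChainSetup

end MetricFlowPair

end Literature.Geometry.Riemannian

end
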